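/- WIDTH seat `ym-line-cbag-p1-w3` (prover-ym-line-cbag-p1-w3-g17-0), LINE 7 `GlueballBandRecursion`, sub-line 7b (volume comparison,
LEAD g29), in support of ⟨stmt-QuantumFields-22957⟩: INCLUSION OF SUPPORT CLASSES OF THE BOX SYSTEM — the support functional of a label set
that does not wrap is the same in every larger box (support-level twin of `PeriodicBoxInclusion.sum_small_boxRooted_eq_of_le`, keyed
on extent, no size filter).  Route-independent; definition-free; a helper. -/
import Summits.QuantumFields.YangMills.Theorems.GlueballBandRecursionSupportExpansion
import Literature.MathematicalPhysics.QuantumFieldTheory.PeriodicBoxInclusion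

/-!
# Route `GlueballBandRecursion`, line 7b: support classes of the box plaquette system — inclusion of boxes

Write `ψ_n(A)(z) = Σ_{𝒞 ⊆ 𝒫(A), ⋃𝒞 = A} Φ^T(𝒞)` for the support functional of the cluster expansion of the box plaquette system
`boxSystem ρ n` (`Support.pertLogZ_eq_sum_support`: `log Z(W) = Σ_{A ⊆ W} ψ(A)`; written out, no definition).  A label set `A` is
CLOSED when every bond of every member lies in another member (`∀ p ∈ A, ∀ e ∈ p.bonds, ∃ q ∈ A, q ≠ p ∧ e ∈ q.bonds`; the
no-free-bond condition of `…SlabCount` / `…SupportExpansion`).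

(Non-closed supports with `≥ 2` members vanish on the Dobrushin disc: width seat w4's `Support.support_sum_eq_zero_of_not_closed`,
`…ClosedSupportsBox`, via the free-bond factorisation `FreeBond.partZ_eq_partZ_singleton_mul`.)

* §1 transport along the inclusion `BoxLabel.castLE : BoxLabel n → BoxLabel n'` (`n ≤ n'`, sizes equal off a set of directions `J`,
  `m + 1 ≤ nᵢ` for `i ∈ J`) of `J`-SMALL label sets (`coord j p < m` for `j ∈ J`, `p ∈ A`): coordinates, cardinality, closedness,
  connectedness, and **`support_sum_image_castLE_eq`**: `ψ_{n'}(castLE '' A) = ψ_n(A)` for every `z` (the families of polymers of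
  `castLE '' A` are exactly the images of the families of polymers of `A`; `PlaqSystemLocalIso` with `bonds_castLE`, `cost_castLE`).
* §2 **`sum_support_sum_eq_of_le`**: for ANY predicate `P'` on label sets of the larger box,
  `Σ_{A' J-small, P' A'} ψ_{n'}(A') = Σ_{A J-small, P'(castLE '' A)} ψ_n(A)` — rooted non-wrapping support classes do not see the
  size of the box in the directions of `J`.  With the slab count (`…SlabCount`: a closed family meets every crossed slab in `≥ 4`
  members) a closed connected support with `< 4(a−1)` members, rooted in direction `i`, is `{i}`-small at scale `m = a − 1`
  (`m + 1 = a ≤ nᵢ`): the closedness-aware transplant between `boxSystem ρ ![a,a,a,t]` and the boxes with one side enlarged.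

HONEST FRAMING.  Finite combinatorics / bookkeeping for the ∃-window strong-coupling RECORD-rung line 7b; item 22957, the volume
comparison, the rung `ColdDoublingRecursionStrongCoupling` and the Yang–Mills mass gap / the summit `YangMills` are NOT proved or advanced.
-/

set_option autoImplicit false

noncomputable section

open MeasureTheory Finset
open Literature.Probability.LatticeModels
open Literature.MathematicalPhysics.QuantumFieldTheory

namespace Summit.QuantumFields.YangMills.Theorems.GlueballBandRecursion.BoxSupport

/-! ## §1 Transport of `J`-small label sets along the inclusion of boxes -/

section Transport

variable {d : ℕ} {n n' : Fin d → ℕ}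

/-- Coordinates are unchanged by the inclusion. -/
theorem coord_castLE (h : ∀ i, n i ≤ n' i) (j : Fin d) (p : BoxLabel n) :
    BoxLabel.coord j (BoxLabel.castLE h p) = BoxLabel.coord j p := rfl

/-- The image of a label set under the inclusion has the same cardinality. -/
theorem card_image_castLE (h : ∀ i, n i ≤ n' i) (A : Finset (BoxLabel n)) :
    (A.image (BoxLabel.castLE h)).card = A.card :=
  Finset.card_image_of_injective _ (BoxLabel.castLE_injective h)

/-- `J`-smallness is transported: the image of a label set with `J`-coordinates `< m` has `J`-coordinates `< m`, and conversely. -/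
theorem small_image_castLE_iff (h : ∀ i, n i ≤ n' i) (J : Finset (Fin d)) (m : ℕ) (A : Finset (BoxLabel n)) :
    (∀ p' ∈ A.image (BoxLabel.castLE h), ∀ j ∈ J, BoxLabel.coord j p' < m) ↔
      ∀ p ∈ A, ∀ j ∈ J, BoxLabel.coord j p < m := by
  simp only [Finset.mem_image, forall_exists_index, and_imp, forall_apply_eq_imp_iff₂, coord_castLE]

/-- **Closedness is transported**: a `J`-small label set is closed iff its image under the inclusion is (the bonds of `J`-small labels
are unchanged, `BoxLabel.bonds_castLE`). -/
theorem closed_image_castLE_iff (h : ∀ i, n i ≤ n' i) {J : Finset (Fin d)} (hJ : ∀ i, i ∉ J → n i = n' i) {m : ℕ}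
    (hm : ∀ i ∈ J, m + 1 ≤ n i) {A : Finset (BoxLabel n)} (hA : ∀ p ∈ A, ∀ j ∈ J, BoxLabel.coord j p < m) :
    (∀ p' ∈ A.image (BoxLabel.castLE h), ∀ e ∈ p'.bonds, ∃ q' ∈ A.image (BoxLabel.castLE h), q' ≠ p' ∧ e ∈ q'.bonds) ↔
      ∀ p ∈ A, ∀ e ∈ p.bonds, ∃ q ∈ A, q ≠ p ∧ e ∈ q.bonds := by
  have hb : ∀ p ∈ A, (BoxLabel.castLE h p).bonds = p.bonds := fun p hp => BoxLabel.bonds_castLE h hJ hm (hA p hp)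
  have hinj := BoxLabel.castLE_injective h
  constructor
  · intro hc p hp e he
    obtain ⟨q', hq', hne, heq'⟩ := hc _ (Finset.mem_image_of_mem _ hp) e (by rwa [hb p hp])
    obtain ⟨q, hq, rfl⟩ := Finset.mem_image.1 hq'
    refine ⟨q, hq, fun hqp => hne (by rw [hqp]), ?_⟩
    rwa [hb q hq] at heq'
  · intro hc p' hp' e he
    obtain ⟨p, hp, rfl⟩ := Finset.mem_image.1 hp'
    rw [hb p hp] at he
    obtain ⟨q, hq, hne, heq⟩ := hc p hp e he
    exact ⟨BoxLabel.castLE h q, Finset.mem_image_of_mem _ hq, fun hqp => hne (hinj hqp), by rwa [hb q hq]⟩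

variable {G : Type*} [Group G] {N : ℕ} (ρ : G →* Matrix (Fin N) (Fin N) ℂ)
  [TopologicalSpace G] [IsTopologicalGroup G] [CompactSpace G] [MeasurableSpace G] [BorelSpace G]

omit [TopologicalSpace G] [IsTopologicalGroup G] [CompactSpace G] [MeasurableSpace G] [BorelSpace G] in
/-- **Connectedness is transported**: a `J`-small label set is connected for the adjacency of the box system of sizes `n` iff its
image is connected for that of sizes `n'` (`PlaqSystem.isRConnected_image_iff`). -/
theorem isRConnected_image_castLE_iff (h : ∀ i, n i ≤ n' i) {J : Finset (Fin d)} (hJ : ∀ i, i ∉ J → n i = n' i) {m : ℕ}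
    (hm : ∀ i ∈ J, m + 1 ≤ n i) {A : Finset (BoxLabel n)} (hA : ∀ p ∈ A, ∀ j ∈ J, BoxLabel.coord j p < m) :
    IsRConnected (boxSystem (G := G) ρ n').Adj (A.image (BoxLabel.castLE h)) ↔ IsRConnected (boxSystem (G := G) ρ n).Adj A := by
  have h1 : ∀ p ∈ A, (boxSystem (G := G) ρ n').bonds (BoxLabel.castLE h p) = ((boxSystem (G := G) ρ n).bonds p).image id :=
    fun p hp => by rw [Finset.image_id]; exact BoxLabel.bonds_castLE h hJ hm (hA p hp)
  exact PlaqSystem.isRConnected_image_iff h1 (Set.injOn_id _) (BoxLabel.castLE_injective h).injOn Finset.Subset.rfl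

/-- **The support functional of a non-wrapping label set does not see the size of the box.**  Sizes `n ≤ n'` agreeing outside `J`,
`m + 1 ≤ nᵢ` for `i ∈ J`, and a label set `A` whose `J`-coordinates are `< m`.  Then for every complex `z` the support sum of the
image `castLE '' A` in the box of sizes `n'` equals the support sum of `A` in the box of sizes `n`:
`Σ_{𝒞' ⊆ 𝒫_{n'}(castLE '' A), ⋃𝒞' = castLE '' A} Φ^T_{n'}(𝒞') = Σ_{𝒞 ⊆ 𝒫_n(A), ⋃𝒞 = A} Φ^T_n(𝒞)` — along the inclusion the labels of `A`
keep their bonds and costs (`bonds_castLE`, `cost_castLE`), so polymers, families with union `A` and `Φ^T` correspond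
(`PlaqSystemLocalIso`). [cite: SeilerLNP1982, Ch. 2] -/
theorem support_sum_image_castLE_eq (hρ : Continuous ρ) (h : ∀ i, n i ≤ n' i) {J : Finset (Fin d)}
    (hJ : ∀ i, i ∉ J → n i = n' i) {m : ℕ} (hm : ∀ i ∈ J, m + 1 ≤ n i) {A : Finset (BoxLabel n)}
    (hA : ∀ p ∈ A, ∀ j ∈ J, BoxLabel.coord j p < m) (z : ℂ) :
    ∑ 𝒞 ∈ (rconnSubsets (boxSystem (G := G) ρ n').Adj (A.image (BoxLabel.castLE h))).powerset with
        𝒞.biUnion id = A.image (BoxLabel.castLE h),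
        truncatedWeight (GeomInc (boxSystem (G := G) ρ n').Adj)
          (connActivity (boxSystem (G := G) ρ n').Adj (zdHaar d G) ((boxSystem (G := G) ρ n').weight z)) 𝒞 =
      ∑ 𝒞 ∈ (rconnSubsets (boxSystem (G := G) ρ n).Adj A).powerset with 𝒞.biUnion id = A,
        truncatedWeight (GeomInc (boxSystem (G := G) ρ n).Adj)
          (connActivity (boxSystem (G := G) ρ n).Adj (zdHaar d G) ((boxSystem (G := G) ρ n).weight z)) 𝒞 := by
  classical
  set T := boxSystem (G := G) ρ n with hT
  set T' := boxSystem (G := G) ρ n' with hT'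
  set cast : BoxLabel n → BoxLabel n' := BoxLabel.castLE h with hcast
  set castF : Finset (Finset (BoxLabel n)) → Finset (Finset (BoxLabel n')) := fun 𝒞 => 𝒞.image (Finset.image cast)
    with hcastF
  have hR := boxSystem_regular (d := d) (G := G) ρ hρ n
  -- the local isomorphism along `cast` on `A` (identity relabelling of bonds)
  have h1 : ∀ p ∈ A, T'.bonds (cast p) = (T.bonds p).image id := fun p hp => by
    rw [Finset.image_id]; exact BoxLabel.bonds_castLE h hJ hm (hA p hp)
  have h2 : Set.InjOn (id : ZdEdge d → ZdEdge d) (↑(A.biUnion T.bonds) : Set (ZdEdge d)) := Set.injOn_id _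
  have h3 : ∀ p ∈ A, ∀ U : ZdGaugeConfig d G, T'.cost (cast p) U = T.cost p (U ∘ id) := fun p hp U => by
    rw [Function.comp_id]; exact BoxLabel.cost_castLE ρ h hJ hm (hA p hp) U
  have hinj : Function.Injective cast := BoxLabel.castLE_injective h
  have h4 : Set.InjOn cast A := hinj.injOn
  -- index sets
  set I := (rconnSubsets T.Adj A).powerset.filter fun 𝒞 => 𝒞.biUnion id = A with hI
  set I' := (rconnSubsets T'.Adj (A.image cast)).powerset.filter fun 𝒞 => 𝒞.biUnion id = A.image cast with hI'
  have hmemI : ∀ {𝒞}, 𝒞 ∈ I → ∀ Y ∈ 𝒞, Y ⊆ A := fun h𝒞 Y hY =>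
    (mem_rconnSubsets.1 (Finset.mem_powerset.1 (Finset.mem_filter.1 h𝒞).1 hY)).1
  have hunion : ∀ 𝒞 : Finset (Finset (BoxLabel n)), (castF 𝒞).biUnion id = (𝒞.biUnion id).image cast := fun 𝒞 => by
    rw [hcastF, Finset.biUnion_image, Finset.image_biUnion]
    rfl
  -- the images of the families of `I` lie in `I'`
  have hto : ∀ {𝒞}, 𝒞 ∈ I → castF 𝒞 ∈ I' := by
    intro 𝒞 h𝒞
    obtain ⟨h𝒞sub, hsup⟩ := Finset.mem_filter.1 h𝒞
    refine Finset.mem_filter.2 ⟨Finset.mem_powerset.2 fun Y' hY' => ?_, by rw [hunion, hsup]⟩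
    obtain ⟨Y, hY, rfl⟩ := Finset.mem_image.1 hY'
    have hYA := mem_rconnSubsets.1 (Finset.mem_powerset.1 h𝒞sub hY)
    exact (PlaqSystem.mem_rconnSubsets_image_iff h1 h2 h4 hYA.1 Finset.Subset.rfl).2 hYA.2
  -- every family of `I'` is such an image: pull back member by member inside `A`
  set pull : Finset (BoxLabel n') → Finset (BoxLabel n) := fun Y' => A.filter fun p => cast p ∈ Y' with hpull
  have hpull_image : ∀ {Y' : Finset (BoxLabel n')}, Y' ⊆ A.image cast → (pull Y').image cast = Y' := by
    intro Y' hY'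
    ext p'
    simp only [hpull, Finset.mem_image, Finset.mem_filter]
    constructor
    · rintro ⟨p, ⟨-, hp⟩, rfl⟩; exact hp
    · intro hp'
      obtain ⟨p, hp, rfl⟩ := Finset.mem_image.1 (hY' hp')
      exact ⟨p, ⟨hp, hp'⟩, rfl⟩
  have hfrom : ∀ {𝒞'}, 𝒞' ∈ I' → 𝒞'.image pull ∈ I ∧ castF (𝒞'.image pull) = 𝒞' := by
    intro 𝒞' h𝒞'
    obtain ⟨h𝒞'sub, hsup'⟩ := Finset.mem_filter.1 h𝒞'
    have hY'A : ∀ Y' ∈ 𝒞', Y' ⊆ A.image cast ∧ IsRConnected T'.Adj Y' := fun Y' hY' =>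
      mem_rconnSubsets.1 (Finset.mem_powerset.1 h𝒞'sub hY')
    have hcastF : castF (𝒞'.image pull) = 𝒞' := by
      rw [hcastF]
      simp only [Finset.image_image]
      conv_rhs => rw [← Finset.image_id (s := 𝒞')]
      exact Finset.image_congr fun Y' hY' => by
        simpa using hpull_image (hY'A Y' (Finset.mem_coe.1 hY')).1
    refine ⟨Finset.mem_filter.2 ⟨Finset.mem_powerset.2 fun Y hY => ?_, ?_⟩, hcastF⟩
    · obtain ⟨Y', hY', rfl⟩ := Finset.mem_image.1 hY
      have hsub : pull Y' ⊆ A := Finset.filter_subset _ _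
      refine mem_rconnSubsets.2 ⟨hsub, ?_⟩
      rw [← PlaqSystem.isRConnected_image_iff h1 h2 h4 hsub, hpull_image (hY'A Y' hY').1]
      exact (hY'A Y' hY').2
    · refine Finset.Subset.antisymm (Finset.biUnion_subset.2 fun Y hY => ?_) fun p hp => ?_
      · obtain ⟨Y', -, rfl⟩ := Finset.mem_image.1 hY
        exact Finset.filter_subset _ _
      · have hp' : cast p ∈ 𝒞'.biUnion id := by rw [hsup']; exact Finset.mem_image_of_mem _ hp
        obtain ⟨Y', hY', hpY'⟩ := Finset.mem_biUnion.1 hp'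
        exact Finset.mem_biUnion.2 ⟨pull Y', Finset.mem_image_of_mem _ hY', Finset.mem_filter.2 ⟨hp, hpY'⟩⟩
  have himage : I' = I.image castF := by
    ext 𝒞'
    constructor
    · intro h𝒞'
      obtain ⟨hmem, heq⟩ := hfrom h𝒞'
      exact Finset.mem_image.2 ⟨_, hmem, heq⟩
    · intro h𝒞'
      obtain ⟨𝒞, h𝒞, rfl⟩ := Finset.mem_image.1 h𝒞'
      exact hto h𝒞
  have hinjF : Set.InjOn castF (I : Set (Finset (Finset (BoxLabel n)))) :=
    (Finset.image_injective (Finset.image_injective hinj)).injOn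
  rw [himage, Finset.sum_image hinjF]
  exact Finset.sum_congr rfl fun 𝒞 h𝒞 => PlaqSystem.truncatedWeight_image_image_eq hR h1 h2 h3 h4 (hmemI h𝒞) z

/-! ## §2 Sums of support functionals over non-wrapping classes agree across box sizes -/

/-- **Rooted non-wrapping support classes do not see the size of the box.**  Sizes `n ≤ n'` (all `nᵢ ≥ 1`) agreeing outside `J`,
`m + 1 ≤ nᵢ` for `i ∈ J`, and ANY predicate `P'` on label sets of the larger box.  Then the sum of the support functionals of the larger
box over the `J`-small label sets satisfying `P'` equals the sum of the support functionals of the smaller box over the `J`-small label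
sets whose image satisfies `P'`:
`Σ_{A' : J-small, P' A'} ψ_{n'}(A') = Σ_{A : J-small, P'(castLE '' A)} ψ_n(A)`
(the `J`-small label sets of the two boxes correspond bijectively under `castLE`, and `support_sum_image_castLE_eq`).  Use: `P'` =
«closed, connected, rooted, fewer than `4(a−1)` members, …» — by `closed_image_castLE_iff`, `isRConnected_image_castLE_iff`,
`card_image_castLE`, `coord_castLE` these read the same on `A`. [cite: SeilerLNP1982, Ch. 2] -/
theorem sum_support_sum_eq_of_le (hρ : Continuous ρ) (h : ∀ i, n i ≤ n' i) (J : Finset (Fin d))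
    (hJ : ∀ i, i ∉ J → n i = n' i) {m : ℕ} (hm : ∀ i ∈ J, m + 1 ≤ n i) (hn : ∀ i, 0 < n i)
    (P' : Finset (BoxLabel n') → Prop) [DecidablePred P'] (z : ℂ) :
    ∑ A' ∈ (Finset.univ : Finset (BoxLabel n')).powerset with
        (∀ p' ∈ A', ∀ j ∈ J, BoxLabel.coord j p' < m) ∧ P' A',
        ∑ 𝒞 ∈ (rconnSubsets (boxSystem (G := G) ρ n').Adj A').powerset with 𝒞.biUnion id = A',
          truncatedWeight (GeomInc (boxSystem (G := G) ρ n').Adj)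
            (connActivity (boxSystem (G := G) ρ n').Adj (zdHaar d G) ((boxSystem (G := G) ρ n').weight z)) 𝒞 =
      ∑ A ∈ (Finset.univ : Finset (BoxLabel n)).powerset with
        (∀ p ∈ A, ∀ j ∈ J, BoxLabel.coord j p < m) ∧ P' (A.image (BoxLabel.castLE h)),
        ∑ 𝒞 ∈ (rconnSubsets (boxSystem (G := G) ρ n).Adj A).powerset with 𝒞.biUnion id = A,
          truncatedWeight (GeomInc (boxSystem (G := G) ρ n).Adj)
            (connActivity (boxSystem (G := G) ρ n).Adj (zdHaar d G) ((boxSystem (G := G) ρ n).weight z)) 𝒞 := by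
  classical
  set cast : BoxLabel n → BoxLabel n' := BoxLabel.castLE h with hcast
  have hinj : Function.Injective cast := BoxLabel.castLE_injective h
  set SA := (Finset.univ : Finset (BoxLabel n)).powerset.filter fun A =>
    (∀ p ∈ A, ∀ j ∈ J, BoxLabel.coord j p < m) ∧ P' (A.image cast) with hSA
  set SA' := (Finset.univ : Finset (BoxLabel n')).powerset.filter fun A' =>
    (∀ p' ∈ A', ∀ j ∈ J, BoxLabel.coord j p' < m) ∧ P' A' with hSA'
  -- the partial inverse on labels with all coordinates below `n`
  set down : BoxLabel n' → BoxLabel n := fun p' => (fun j => ⟨(p'.1 j : ℕ) % n j, Nat.mod_lt _ (hn j)⟩, p'.2) with hdown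
  have hcast_down : ∀ p' : BoxLabel n', (∀ j, BoxLabel.coord j p' < n j) → cast (down p') = p' := by
    intro p' hp'
    refine Prod.ext (funext fun j => Fin.ext ?_) rfl
    simp only [hcast, BoxLabel.castLE, BoxSite.castLE, Fin.val_castLE, hdown]
    exact Nat.mod_eq_of_lt (hp' j)
  have himage : SA' = SA.image (Finset.image cast) := by
    ext A'
    constructor
    · intro hA'
      obtain ⟨-, hsmall', hP'⟩ := Finset.mem_filter.1 hA'
      -- all coordinates of the labels of `A'` are below `n`
      have hlt : ∀ p' ∈ A', ∀ j, BoxLabel.coord j p' < n j := by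
        intro p' hp' j
        by_cases hj : j ∈ J
        · exact lt_of_lt_of_le (hsmall' p' hp' j hj) (by have := hm j hj; omega)
        · rw [hJ j hj]; exact BoxLabel.coord_lt j p'
      have heq : (A'.image down).image cast = A' := by
        rw [Finset.image_image]
        conv_rhs => rw [← Finset.image_id (s := A')]
        exact Finset.image_congr fun p' hp' => by simpa using hcast_down p' (hlt p' (Finset.mem_coe.1 hp'))
      have hsmall : ∀ p ∈ A'.image down, ∀ j ∈ J, BoxLabel.coord j p < m := by
        intro p hp j hj
        obtain ⟨p', hp', rfl⟩ := Finset.mem_image.1 hp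
        have hc : BoxLabel.coord j (down p') = BoxLabel.coord j p' := by
          simp only [BoxLabel.coord, hdown]
          exact Nat.mod_eq_of_lt (hlt p' hp' j)
        rw [hc]
        exact hsmall' p' hp' j hj
      refine Finset.mem_image.2 ⟨A'.image down, Finset.mem_filter.2 ⟨Finset.mem_powerset.2 (Finset.subset_univ _),
        hsmall, by rwa [heq]⟩, heq⟩
    · intro hA'
      obtain ⟨A, hASA, rfl⟩ := Finset.mem_image.1 hA'
      obtain ⟨-, hsmall, hP'⟩ := Finset.mem_filter.1 hASA
      exact Finset.mem_filter.2 ⟨Finset.mem_powerset.2 (Finset.subset_univ _),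
        (small_image_castLE_iff h J m A).2 hsmall, hP'⟩
  have hinjS : Set.InjOn (Finset.image cast) (SA : Set (Finset (BoxLabel n))) := (Finset.image_injective hinj).injOn
  rw [himage, Finset.sum_image hinjS]
  exact Finset.sum_congr rfl fun A hASA =>
    support_sum_image_castLE_eq ρ hρ h hJ hm (Finset.mem_filter.1 hASA).2.1 z

/-! ## §3 Matching predicates on the two boxes (appended for the lifting assembly, width seat w5's (R3)) -/

omit [TopologicalSpace G] [IsTopologicalGroup G] [CompactSpace G] [MeasurableSpace G] [BorelSpace G] in
/-- **Rootedness is transported**: a label set is rooted in direction `i` at scale `k` (all `i`-coordinates `< k`, some equal to `0`) iff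
its image under the inclusion is (coordinates are unchanged). -/
theorem rooted_image_castLE_iff (h : ∀ i, n i ≤ n' i) (i : Fin d) (k : ℕ) (A : Finset (BoxLabel n)) :
    ((∀ p' ∈ A.image (BoxLabel.castLE h), BoxLabel.coord i p' < k) ∧ ∃ p' ∈ A.image (BoxLabel.castLE h), BoxLabel.coord i p' = 0) ↔
      (∀ p ∈ A, BoxLabel.coord i p < k) ∧ ∃ p ∈ A, BoxLabel.coord i p = 0 := by
  simp only [Finset.mem_image, forall_exists_index, and_imp, forall_apply_eq_imp_iff₂, coord_castLE, exists_exists_and_eq_and]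

/-- **Sums over matching classes agree across box sizes.**  As `sum_support_sum_eq_of_le`, with a predicate `P` on the label sets of the
smaller box and `P'` on those of the larger box that MATCH on `J`-small sets (`P' (castLE '' A) ↔ P A` whenever `A` is `J`-small):
`Σ_{A' J-small, P' A'} ψ_{n'}(A') = Σ_{A J-small, P A} ψ_n(A)`.  For the 7b kept classes («closed ∧ connected ∧ #A ≤ 4(a−1) ∧ rooted»)
the matching is `closed_image_castLE_iff`, `isRConnected_image_castLE_iff`, `card_image_castLE`, `rooted_image_castLE_iff`.
[cite: SeilerLNP1982, Ch. 2] -/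
theorem sum_support_sum_eq_of_le_of_iff (hρ : Continuous ρ) (h : ∀ i, n i ≤ n' i) (J : Finset (Fin d))
    (hJ : ∀ i, i ∉ J → n i = n' i) {m : ℕ} (hm : ∀ i ∈ J, m + 1 ≤ n i) (hn : ∀ i, 0 < n i)
    (P : Finset (BoxLabel n) → Prop) [DecidablePred P] (P' : Finset (BoxLabel n') → Prop) [DecidablePred P']
    (hPP' : ∀ A : Finset (BoxLabel n), (∀ p ∈ A, ∀ j ∈ J, BoxLabel.coord j p < m) → (P' (A.image (BoxLabel.castLE h)) ↔ P A))
    (z : ℂ) :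
    ∑ A' ∈ (Finset.univ : Finset (BoxLabel n')).powerset with
        (∀ p' ∈ A', ∀ j ∈ J, BoxLabel.coord j p' < m) ∧ P' A',
        ∑ 𝒞 ∈ (rconnSubsets (boxSystem (G := G) ρ n').Adj A').powerset with 𝒞.biUnion id = A',
          truncatedWeight (GeomInc (boxSystem (G := G) ρ n').Adj)
            (connActivity (boxSystem (G := G) ρ n').Adj (zdHaar d G) ((boxSystem (G := G) ρ n').weight z)) 𝒞 =
      ∑ A ∈ (Finset.univ : Finset (BoxLabel n)).powerset with
        (∀ p ∈ A, ∀ j ∈ J, BoxLabel.coord j p < m) ∧ P A,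
        ∑ 𝒞 ∈ (rconnSubsets (boxSystem (G := G) ρ n).Adj A).powerset with 𝒞.biUnion id = A,
          truncatedWeight (GeomInc (boxSystem (G := G) ρ n).Adj)
            (connActivity (boxSystem (G := G) ρ n).Adj (zdHaar d G) ((boxSystem (G := G) ρ n).weight z)) 𝒞 := by
  classical
  rw [sum_support_sum_eq_of_le ρ hρ h J hJ hm hn P' z]
  refine Finset.sum_congr (Finset.filter_congr fun A _ => ?_) fun _ _ => rfl
  exact ⟨fun hA => ⟨hA.1, (hPP' A hA.1).1 hA.2⟩, fun hA => ⟨hA.1, (hPP' A hA.1).2 hA.2⟩⟩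

omit [TopologicalSpace G] [IsTopologicalGroup G] [CompactSpace G] [MeasurableSpace G] [BorelSpace G] in
/-- **The 7b kept classes match across box sizes** (closed ∧ connected ∧ at most `k` members ∧ rooted in direction `i` at scale `m₀`),
on `J`-small label sets. -/
theorem kept_image_castLE_iff (h : ∀ i, n i ≤ n' i) {J : Finset (Fin d)} (hJ : ∀ i, i ∉ J → n i = n' i) {m : ℕ}
    (hm : ∀ i ∈ J, m + 1 ≤ n i) (i : Fin d) (k m₀ : ℕ) {A : Finset (BoxLabel n)}
    (hA : ∀ p ∈ A, ∀ j ∈ J, BoxLabel.coord j p < m) :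
    ((∀ p' ∈ A.image (BoxLabel.castLE h), ∀ e ∈ p'.bonds, ∃ q' ∈ A.image (BoxLabel.castLE h), q' ≠ p' ∧ e ∈ q'.bonds) ∧
        IsRConnected (boxSystem (G := G) ρ n').Adj (A.image (BoxLabel.castLE h)) ∧
        (A.image (BoxLabel.castLE h)).card ≤ k ∧
        ((∀ p' ∈ A.image (BoxLabel.castLE h), BoxLabel.coord i p' < m₀) ∧
          ∃ p' ∈ A.image (BoxLabel.castLE h), BoxLabel.coord i p' = 0)) ↔
      ((∀ p ∈ A, ∀ e ∈ p.bonds, ∃ q ∈ A, q ≠ p ∧ e ∈ q.bonds) ∧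
        IsRConnected (boxSystem (G := G) ρ n).Adj A ∧ A.card ≤ k ∧
        ((∀ p ∈ A, BoxLabel.coord i p < m₀) ∧ ∃ p ∈ A, BoxLabel.coord i p = 0)) := by
  rw [closed_image_castLE_iff h hJ hm hA, isRConnected_image_castLE_iff ρ h hJ hm hA, card_image_castLE,
    rooted_image_castLE_iff]

end Transport

end Summit.QuantumFields.YangMills.Theorems.GlueballBandRecursion.BoxSupport

end
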